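import Literature.NumberTheory.QuadraticForms.NumberFieldRepresentsCriteria
import HarnessLib

/-!
# Quadratic forms over totally complex number fields are universal in rank `≥ 4` (O'Meara 66:3, §63C, §61B)

Topic `NumberTheory/QuadraticForms`; namespace `Literature.NumberTheory.QuadraticForms`. Everything here
is proved. Over a **totally complex** number field `F` (no real spots: every archimedean completion is
`ℂ`, §61B) the archimedean conditions in the local–global criteria of
`NumberFieldRepresentsCriteria.lean` are void, so O'Meara 66:3 (representation of a scalar, local–global)
with the Corollary to Serre's Ch. IV §2.2 Thm 6 at the finite spots ("`n ≥ 4`: every `a ∈ F_v^*` is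
represented") gives: every nondegenerate diagonal form of rank `≥ 4` over `F` represents every element
of `F`. (The companion statement in rank `≥ 5` — isotropy, O'Meara 66:1 with 63:19 — is the tree's
`diagIsotropic_of_five_le_of_isTotallyComplex`, `HasseMinkowskiNumberField.lean`.)

* `isEmpty_ringHom_real_of_isTotallyComplex` — a totally complex field has no embedding into `ℝ`;
* `exists_sum_mul_sq_eq_of_four_le_of_isTotallyComplex` — universality in rank `≥ 4`.

## References

* O. T. O'Meara, *Introduction to Quadratic Forms*, Grundlehren 117, Springer 1963, §66 Thm 66:3,
  §63C, §61B [corpus:book:o-meara1963-introduction-quadratic-forms p0192–p0194]. [Omeara1963]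
-/

noncomputable section

open NumberField IsDedekindDomain

namespace Literature.NumberTheory.QuadraticForms

/-- **A totally complex number field has no real embedding** (an embedding `ρ : F → ℝ` would define a
real infinite place `mk (ρ : F → ℂ)`; §61: the archimedean spots are real or complex).
[cite: Omeara1963, §61A–B pp. 154–155] -/
theorem isEmpty_ringHom_real_of_isTotallyComplex (F : Type*) [Field F] [NumberField F]
    [IsTotallyComplex F] : IsEmpty (F →+* ℝ) :=
  ⟨fun ρ => absurd (show ComplexEmbedding.IsReal (Complex.ofRealHom.comp ρ) from
      ComplexEmbedding.isReal_iff.mpr (by ext x; simp [ComplexEmbedding.conjugate_coe_eq]))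
    (IsTotallyComplex.complexEmbedding_not_isReal _)⟩

/-- **Over a totally complex number field every nondegenerate form of rank `≥ 4` is universal**
(O'Meara 66:3 with the Corollary to Serre IV §2.2 Thm 6 at the finite spots and §61B at the
archimedean ones). [cite: Omeara1963, §66 Thm 66:3 p. 189] -/
theorem exists_sum_mul_sq_eq_of_four_le_of_isTotallyComplex (F : Type) [Field F] [NumberField F]
    [IsTotallyComplex F] {n : ℕ} (hn : 4 ≤ n) (c : Fin n → F) (hc : ∀ i, c i ≠ 0) (a : F) :
    ∃ x : Fin n → F, ∑ i, c i * x i ^ 2 = a := by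
  by_cases ha : a = 0
  · exact ⟨0, by simp [ha]⟩
  · exact (exists_sum_mul_sq_eq_numberField_iff_of_four_le F hn c hc ha).mpr fun ρ =>
      ((isEmpty_ringHom_real_of_isTotallyComplex F).false ρ).elim

end Literature.NumberTheory.QuadraticForms

end
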